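import Summits.BirchSwinnertonDyer.BirchSwinnertonDyer.Theorems.TwoAdicConverseTwoTorsionAtoms
import Summits.BirchSwinnertonDyer.BirchSwinnertonDyer.Theses.KolyvaginRankRigidityAtTwo
import HarnessLib

/-!
# Route `KolyvaginRankRigidityAtTwo`, item 27124 `OffHabitatRedNonSurjTwoConverse` (the RESIDUAL of LINE 8: the leaf off
# the `2`-adic habitat at curves WITH a rational `2`-torsion point): it IS the (β) piece of the leaf, and it splits
# losslessly into the two Greenberg configurations (M)/(R) and into the three twist-closed ATOMS A₁ / A₂ / A₃

Cell `bsd-2adic` (run/shared/lean/pub/bsd-2adic/), seat `bsd-2adic-conv-1` (GEN 20; S3's off-habitat remit, RC-209).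
THEOREMS ONLY — no definition, no named fact, no `sorry`.  HONEST FRAMING: item 27124 is OPEN (declared residual of KRR2's
LINE 8, «Eisenstein prime 2»); nothing here proves it; this file only identifies it, kernel-checked, with binders the
S3 lineage has already decomposed, so that the planner's future «Eisenstein-2 abelian squeeze» line can be filed per
ATOM.  BSD is not proved by any of this; nothing is booked (D-0054).  PARTITION: none — RANK axis (S3 leaf
`NonCMTwoConverse` / KRR2 residual 24303 ⊃ 27124), stratum (β) at a good-ordinary OR multiplicative `2`.

* §1 `torsionBy_two_ne_bot_iff_exists` (`E(ℚ)[2] ≠ 0` ⟺ a rational point of exact order `2`),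
  `not_forall_hasSurjectiveModNGaloisRep_two_pow_of_two_torsion` (such a curve is OFF the habitat: `ρ̄_{E,2}` is not
  onto), hence **`offHabitatRedNonSurjTwoConverse_iff_twoTorsion_leaf`: 27124 ⟺ the `h2t` binder of
  `leaf_offBigImage_of_strata`** (the habitat hypothesis of 27124 is idle).
* §2 27124 ⇐ (M) mixed ∧ (R) ramified-odd (`offHabitatRedNonSurjTwoConverse_of_mixed_of_ramifiedOdd`, conv-1 GEN 20
  p629321), and 27124 ⟺ A₁ ∧ A₂ ∧ A₃ (`offHabitatRedNonSurjTwoConverse_iff_atoms`, p630731): the atoms are closed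
  under the `2`-isogeny `P ↦ P'` and under the admissible twists `d ≡ 1 (mod 4)` (p630037 / p630697), (M)/(R) are not.

References: R. Greenberg, LNM 1716 (1999), §5 Props. 5.13–5.14 [GreenbergLNM1716]; T. & V. Dokchitser, Math. Z. 272
(2012) [DokchitserDokchitserMathZ2012]; J. Rouse, D. Zureick-Brown, Res. Number Theory 1 (2015) [RouseZureickbrown2015].
-/

set_option linter.dupNamespace false  -- `BirchSwinnertonDyer.BirchSwinnertonDyer` is the sub's path (D-0017)
set_option autoImplicit false

noncomputable section

open scoped Classical
open WeierstrassCurve Literature Literature.NumberTheory.EllipticCurves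
  Literature.NumberTheory.EllipticCurves.Rank1Residual
  Literature.NumberTheory.EllipticCurves.Greenberg1999
  Summit.BirchSwinnertonDyer.BirchSwinnertonDyer.Theses.KolyvaginRankRigidityAtTwo

namespace Summit.BirchSwinnertonDyer.BirchSwinnertonDyer.Theorems.TwoAdicOffHabitat

/-! ## §1 Item 27124 is the (β) piece of the leaf -/

/-- `E(ℚ)[2] ≠ 0` iff `E(ℚ)` has a point of exact order `2`. [folklore] -/
theorem torsionBy_two_ne_bot_iff_exists {A : Type*} [AddCommGroup A] :
    AddSubgroup.torsionBy A (2 : ℤ) ≠ ⊥ ↔ ∃ P : A, P ≠ 0 ∧ 2 • P = 0 := by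
  rw [Ne, eq_bot_iff]
  constructor
  · intro h
    by_contra hne
    apply h
    intro P hP
    have h2 : (2 : ℤ) • P = 0 := (Submodule.mem_torsionBy_iff _ _).mp hP
    rw [show (2 : ℤ) = ((2 : ℕ) : ℤ) from rfl, natCast_zsmul] at h2
    rw [AddSubgroup.mem_bot]
    by_contra hP0
    exact hne ⟨P, hP0, h2⟩
  · rintro ⟨P, hP0, h2⟩ h
    have hmem : P ∈ AddSubgroup.torsionBy A (2 : ℤ) := (Submodule.mem_torsionBy_iff _ _).mpr (by
      change (2 : ℤ) • P = 0
      rw [show (2 : ℤ) = ((2 : ℕ) : ℤ) from rfl, natCast_zsmul]; exact h2)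
    exact hP0 ((AddSubgroup.mem_bot).mp (h hmem))

/-- **A rational point of order `2` puts the curve OFF the `2`-adic habitat**: `ρ̄_{E,2}` is not onto (it fixes a
line of `E[2]`), so `ρ_{E,2^m}` is not onto for all `m`. [cite: DokchitserDokchitserMathZ2012, Introduction (p. 961)] -/
theorem not_forall_hasSurjectiveModNGaloisRep_two_pow_of_two_torsion (W : WeierstrassCurve ℚ) [W.IsElliptic]
    (hP : ∃ P : W.toAffine.Point, P ≠ 0 ∧ 2 • P = 0) :
    ¬ ∀ m : ℕ, W.HasSurjectiveModNGaloisRep (2 ^ m : ℕ) := by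
  intro h
  obtain ⟨P, hP0, h2⟩ := hP
  have h1 : W.HasSurjectiveModNGaloisRep 2 := by simpa using h 1
  exact hP0 (((hasSurjectiveModNGaloisRep_two_iff W).mp h1).1 P h2)

/-- **Item 27124 ⟺ the (β) piece of the `r ≤ 1` leaf on `GoodOrd W 2 ∨ Mult W 2`** (VERBATIM the `h2t` binder of
`leaf_offBigImage_of_strata`): the habitat hypothesis of 27124 is implied by the `2`-torsion point.
[cite: DokchitserDokchitserMathZ2012, Introduction (p. 961)] -/
theorem offHabitatRedNonSurjTwoConverse_iff_twoTorsion_leaf :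
    OffHabitatRedNonSurjTwoConverse ↔
      ∀ (W : WeierstrassCurve ℚ) [W.IsElliptic] [W.IsGloballyMinimal], ¬ W.HasCM →
        (GoodOrd W 2 ∨ Mult W 2) → (∃ P : W.toAffine.Point, P ≠ 0 ∧ 2 • P = 0) →
        ∀ r : ℕ, r ≤ 1 → W.selmerCorank 2 = r → W.analyticRank = r := by
  constructor
  · intro h W _ _ hCM hred hP r hr hc
    exact h W hCM hred r hr hc (not_forall_hasSurjectiveModNGaloisRep_two_pow_of_two_torsion W hP)
      (torsionBy_two_ne_bot_iff_exists.mpr hP)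
  · intro h W _ _ hCM hred r hr hc _ hT
    exact h W hCM hred (torsionBy_two_ne_bot_iff_exists.mp hT) r hr hc

/-! ## §2 Item 27124 from the Greenberg configurations and from the atoms -/

/-- **27124 from (M) and (R)**: the leaf for non-CM semistable-at-`2` curves carrying a Prop-5.14 point (ramified XOR
odd) and for those carrying a Prop-5.13 point (ramified AND odd) give item 27124 («neither» points are traded along
the `2`-isogeny, conv-1 GEN 20 `semistable_twoTorsion_leaf_of_mixed_of_ramifiedOdd`).
[cite: GreenbergLNM1716, §5 Props. 5.13–5.14 (chunks p0168–p0170)] -/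
theorem offHabitatRedNonSurjTwoConverse_of_mixed_of_ramifiedOdd
    (hM : ∀ (W : WeierstrassCurve ℚ) [W.IsElliptic] [W.IsGloballyMinimal], ¬ W.HasCM →
      (GoodOrd W 2 ∨ Mult W 2) →
      (∃ x : ℚ, HasRationalTwoTorsionX W x ∧
        ((TwoTorsionRamifiedAtTwo x ∧ ¬ TwoTorsionOdd W x) ∨ (TwoTorsionOdd W x ∧ ¬ TwoTorsionRamifiedAtTwo x))) →
      ∀ r : ℕ, r ≤ 1 → W.selmerCorank 2 = r → W.analyticRank = r)
    (hR : ∀ (W : WeierstrassCurve ℚ) [W.IsElliptic] [W.IsGloballyMinimal], ¬ W.HasCM →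
      (GoodOrd W 2 ∨ Mult W 2) →
      (∃ x : ℚ, HasRationalTwoTorsionX W x ∧ TwoTorsionRamifiedAtTwo x ∧ TwoTorsionOdd W x) →
      ∀ r : ℕ, r ≤ 1 → W.selmerCorank 2 = r → W.analyticRank = r) :
    OffHabitatRedNonSurjTwoConverse :=
  offHabitatRedNonSurjTwoConverse_iff_twoTorsion_leaf.mpr (semistable_twoTorsion_leaf_of_mixed_of_ramifiedOdd hM hR)

/-- **27124 ⟺ the leaf on the three ATOMS A₁ / A₂ / A₃** (lossless: each atom hypothesis exhibits a rational
`2`-torsion point, so 27124 projects onto it; conversely `semistable_twoTorsion_leaf_of_atoms`).  A₁ = «`Δ < 0` ∧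
ramified, or unramified middle», A₂ = «`Δ < 0` ∧ unramified, or ramified middle», A₃ = «`Δ > 0` ∧ extreme point»; each
is closed under `P ↦ P'` and under the admissible twists (`atom₁/₂/₃_twist`).
[cite: GreenbergLNM1716, §5 Props. 5.13–5.14 and Remarks (chunks p0168–p0174)] -/
theorem offHabitatRedNonSurjTwoConverse_iff_atoms :
    OffHabitatRedNonSurjTwoConverse ↔
      ((∀ (W : WeierstrassCurve ℚ) [W.IsElliptic] [W.IsGloballyMinimal], ¬ W.HasCM → (GoodOrd W 2 ∨ Mult W 2) →
        (∃ x : ℚ, HasRationalTwoTorsionX W x ∧ ((W.Δ < 0 ∧ TwoTorsionRamifiedAtTwo x) ∨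
          (¬ TwoTorsionRamifiedAtTwo x ∧ ¬ TwoTorsionOdd W x ∧
            ¬ ∀ r : ℝ, 4 * r ^ 3 + (W.b₂ : ℝ) * r ^ 2 + 2 * (W.b₄ : ℝ) * r + (W.b₆ : ℝ) = 0 → r ≤ (x : ℝ)))) →
        ∀ r : ℕ, r ≤ 1 → W.selmerCorank 2 = r → W.analyticRank = r) ∧
      (∀ (W : WeierstrassCurve ℚ) [W.IsElliptic] [W.IsGloballyMinimal], ¬ W.HasCM → (GoodOrd W 2 ∨ Mult W 2) →
        (∃ x : ℚ, HasRationalTwoTorsionX W x ∧ ((W.Δ < 0 ∧ ¬ TwoTorsionRamifiedAtTwo x) ∨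
          (TwoTorsionRamifiedAtTwo x ∧ ¬ TwoTorsionOdd W x ∧
            ¬ ∀ r : ℝ, 4 * r ^ 3 + (W.b₂ : ℝ) * r ^ 2 + 2 * (W.b₄ : ℝ) * r + (W.b₆ : ℝ) = 0 → r ≤ (x : ℝ)))) →
        ∀ r : ℕ, r ≤ 1 → W.selmerCorank 2 = r → W.analyticRank = r) ∧
      (∀ (W : WeierstrassCurve ℚ) [W.IsElliptic] [W.IsGloballyMinimal], ¬ W.HasCM → (GoodOrd W 2 ∨ Mult W 2) →
        (∃ x : ℚ, HasRationalTwoTorsionX W x ∧ 0 < W.Δ ∧ (TwoTorsionOdd W x ∨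
            ∀ r : ℝ, 4 * r ^ 3 + (W.b₂ : ℝ) * r ^ 2 + 2 * (W.b₄ : ℝ) * r + (W.b₆ : ℝ) = 0 → r ≤ (x : ℝ))) →
        ∀ r : ℕ, r ≤ 1 → W.selmerCorank 2 = r → W.analyticRank = r)) := by
  rw [offHabitatRedNonSurjTwoConverse_iff_twoTorsion_leaf]
  constructor
  · intro h
    refine ⟨fun W _ _ hCM hred hx r hr hc ↦ ?_, fun W _ _ hCM hred hx r hr hc ↦ ?_,
      fun W _ _ hCM hred hx r hr hc ↦ ?_⟩
    · obtain ⟨x, ⟨y, hEq, h2⟩, -⟩ := hx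
      exact h W hCM hred ((exists_two_torsion_iff_exists_hasRationalTwoTorsionX W).mpr ⟨x, y, hEq, h2⟩) r hr hc
    · obtain ⟨x, ⟨y, hEq, h2⟩, -⟩ := hx
      exact h W hCM hred ((exists_two_torsion_iff_exists_hasRationalTwoTorsionX W).mpr ⟨x, y, hEq, h2⟩) r hr hc
    · obtain ⟨x, ⟨y, hEq, h2⟩, -⟩ := hx
      exact h W hCM hred ((exists_two_torsion_iff_exists_hasRationalTwoTorsionX W).mpr ⟨x, y, hEq, h2⟩) r hr hc
  · rintro ⟨h₁, h₂, h₃⟩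
    exact semistable_twoTorsion_leaf_of_atoms h₁ h₂ h₃

/-- **27124 ⟺ (M) ∧ (R)** (lossless as well: each configuration hypothesis exhibits a rational `2`-torsion point).
[cite: GreenbergLNM1716, §5 Props. 5.13–5.14 (chunks p0168–p0170)] -/
theorem offHabitatRedNonSurjTwoConverse_iff_mixed_and_ramifiedOdd :
    OffHabitatRedNonSurjTwoConverse ↔
      ((∀ (W : WeierstrassCurve ℚ) [W.IsElliptic] [W.IsGloballyMinimal], ¬ W.HasCM →
        (GoodOrd W 2 ∨ Mult W 2) →
        (∃ x : ℚ, HasRationalTwoTorsionX W x ∧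
          ((TwoTorsionRamifiedAtTwo x ∧ ¬ TwoTorsionOdd W x) ∨ (TwoTorsionOdd W x ∧ ¬ TwoTorsionRamifiedAtTwo x))) →
        ∀ r : ℕ, r ≤ 1 → W.selmerCorank 2 = r → W.analyticRank = r) ∧
      (∀ (W : WeierstrassCurve ℚ) [W.IsElliptic] [W.IsGloballyMinimal], ¬ W.HasCM →
        (GoodOrd W 2 ∨ Mult W 2) →
        (∃ x : ℚ, HasRationalTwoTorsionX W x ∧ TwoTorsionRamifiedAtTwo x ∧ TwoTorsionOdd W x) →
        ∀ r : ℕ, r ≤ 1 → W.selmerCorank 2 = r → W.analyticRank = r)) := by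
  constructor
  · intro h
    rw [offHabitatRedNonSurjTwoConverse_iff_twoTorsion_leaf] at h
    refine ⟨fun W _ _ hCM hred hx r hr hc ↦ ?_, fun W _ _ hCM hred hx r hr hc ↦ ?_⟩
    · obtain ⟨x, ⟨y, hEq, h2⟩, -⟩ := hx
      exact h W hCM hred ((exists_two_torsion_iff_exists_hasRationalTwoTorsionX W).mpr ⟨x, y, hEq, h2⟩) r hr hc
    · obtain ⟨x, ⟨y, hEq, h2⟩, -⟩ := hx
      exact h W hCM hred ((exists_two_torsion_iff_exists_hasRationalTwoTorsionX W).mpr ⟨x, y, hEq, h2⟩) r hr hc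
  · rintro ⟨hM, hR⟩
    exact offHabitatRedNonSurjTwoConverse_of_mixed_of_ramifiedOdd hM hR

end Summit.BirchSwinnertonDyer.BirchSwinnertonDyer.Theorems.TwoAdicOffHabitat

end
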